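import Summits.Parity.BatemanHorn.Theorems.SelbergDelangeRigidityLSDRealSegmentTailsTwoRankinAux
import HarnessLib

/-!
# Route `SelbergDelangeRigidity`, crux `LSDRealSegment` (stmt-Parity-9770), line
# `product-anatomy-subcritical`: preparation of clause (b) of `stub_tailsTwo` (pointwise Rankin split, `Z`-bounds)

Pointwise form of the split of the Rankin class (`∃ i, smoothPart_{x^θ}(fᵢ(n)) > x^τ`): either the `P`-smooth part of
`fᵢ(n)` exceeds `x^{τ/2}`, or `1 ≤ e^{−τ/(2θ)} · mid^σ` with `σ = 1/(θ log x)` (`tailsTwo_rankin_pointwise`, registered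
helper); the two engine summands (plain peeled weights; the Rankin weight at one member); and the bounds for the density
sums `Z` of the engine: all slices (`≤ K_z K_s^k`) and the slices with `sᵢ > T` (`≤ K_z (K_s+1)^k · tail(T)`).
-/

open Filter Finset Polynomial
open scoped BigOperators Topology Classical

namespace Summit.Parity.BatemanHorn.Cruxes.LSDRealSegment.ProductAnatomySubcritical

open Literature.NumberTheory.Sieve
open ArithmeticFunction (cardFactors)
noncomputable section

variable {k : ℕ}

/-- The class `𝓜(A, B, ε)` grows with `A ≥ 0`. [folklore] -/
theorem IsClassM.mono_A {A A' B ε : ℝ} {F : ℕ → ℝ} (hA : 0 ≤ A) (hAA' : A ≤ A') (h : IsClassM A B ε F) :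
    IsClassM A' B ε F := by
  refine ⟨h.1, fun m n hm hn hmn => (h.2 m n hm hn hmn).trans ?_⟩
  exact mul_le_mul_of_nonneg_right (min_le_min (pow_le_pow_left₀ hA hAA' _) le_rfl) (h.1 n)

/-- **tailsTwo_rankin_pointwise** (registered helper of `stub_tailsTwo`, line `product-anatomy-subcritical`): the pointwise
split of the Rankin class — if `smoothPart_{x^θ}(fᵢ(n)) > x^τ` for some `i` then
`y^{Ω_f(n)} ≤ Σᵢ (1[x^{τ/2} < smoothPart_P(fᵢ(n))] y^{Ω_f(n)} + e^{−τ/(2θ)} y^{Ω_f(n)} (smoothPart_{x^θ}(roughPart_P fᵢ(n)))^{1/(θ log x)})`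
(Rankin's trick on the middle part: `smoothPart_{x^θ} v ≤ smoothPart_P v · smoothPart_{x^θ}(roughPart_P v)`). [folklore] -/
theorem tailsTwo_rankin_pointwise : ∀ (k : ℕ) (f : Fin k → ℤ[X]) (y : ℝ) (P x n : ℕ) (θ τ : ℝ), 0 ≤ y → 0 < θ → 1 < (x : ℝ) →
    (∃ i, (x : ℝ) ^ τ < (smoothPart ((x : ℝ) ^ θ) (val f i n) : ℝ)) →
    y ^ stat f n ≤ ∑ i, ((if (x : ℝ) ^ (τ / 2) < (smoothPart (P : ℝ) (val f i n) : ℝ) then y ^ stat f n else 0) +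
      Real.exp (-(τ / (2 * θ))) * (y ^ stat f n *
        (smoothPart ((x : ℝ) ^ θ) (roughPart (P : ℝ) (val f i n)) : ℝ) ^ (1 / (θ * Real.log x)))) := by
  intro k f y P x n θ τ hy hθ hx ⟨i, hi⟩
  have hx0 : (0 : ℝ) < x := by linarith
  have hlog : 0 < Real.log x := Real.log_pos hx
  set σ : ℝ := 1 / (θ * Real.log x) with hσ
  have hσ0 : 0 < σ := by positivity
  have hterm0 : ∀ j, 0 ≤ (if (x : ℝ) ^ (τ / 2) < (smoothPart (P : ℝ) (val f j n) : ℝ) then y ^ stat f n else 0) +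
      Real.exp (-(τ / (2 * θ))) * (y ^ stat f n * (smoothPart ((x : ℝ) ^ θ) (roughPart (P : ℝ) (val f j n)) : ℝ) ^ σ) := by
    intro j
    refine add_nonneg ?_ (by positivity)
    split_ifs <;> positivity
  refine le_trans ?_ (Finset.single_le_sum (fun j _ => hterm0 j) (Finset.mem_univ i))
  by_cases hcase : (x : ℝ) ^ (τ / 2) < (smoothPart (P : ℝ) (val f i n) : ℝ)
  · rw [if_pos hcase]
    have : 0 ≤ Real.exp (-(τ / (2 * θ))) * (y ^ stat f n * (smoothPart ((x : ℝ) ^ θ) (roughPart (P : ℝ) (val f i n)) : ℝ) ^ σ) := by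
      positivity
    linarith
  · rw [if_neg hcase, zero_add]
    push Not at hcase
    -- the middle part exceeds `x^{τ/2}`
    have hv0 : val f i n ≠ 0 := by rw [val]; positivity
    set mid : ℝ := (smoothPart ((x : ℝ) ^ θ) (roughPart (P : ℝ) (val f i n)) : ℝ) with hmid
    have hmid0 : 0 ≤ mid := Nat.cast_nonneg _
    have hsplit := smoothPart_le_smoothPart_mul_mid ((x : ℝ) ^ θ) P hv0
    have hxτ : 0 < (x : ℝ) ^ (τ / 2) := Real.rpow_pos_of_pos hx0 _
    have hmidge : (x : ℝ) ^ (τ / 2) ≤ mid := by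
      by_contra h
      push Not at h
      have hmidpos : 0 < mid := by rw [hmid]; exact_mod_cast Nat.pos_of_ne_zero (smoothPart_ne_zero _ _)
      have h1 : (smoothPart (P : ℝ) (val f i n) : ℝ) * mid ≤ (x : ℝ) ^ (τ / 2) * mid :=
        mul_le_mul_of_nonneg_right hcase hmid0
      have h2 : (x : ℝ) ^ (τ / 2) * mid < (x : ℝ) ^ (τ / 2) * (x : ℝ) ^ (τ / 2) := mul_lt_mul_of_pos_left h hxτ
      rw [← Real.rpow_add hx0, show τ / 2 + τ / 2 = τ by ring] at h2
      linarith
    -- Rankin: `1 ≤ e^{−τ/(2θ)} mid^σ` since `(x^{τ/2})^σ = e^{τ/(2θ)}`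
    have hpow : ((x : ℝ) ^ (τ / 2)) ^ σ = Real.exp (τ / (2 * θ)) := by
      rw [← Real.rpow_mul hx0.le, Real.rpow_def_of_pos hx0]
      congr 1
      rw [hσ]; field_simp
    have h1 : 1 ≤ Real.exp (-(τ / (2 * θ))) * mid ^ σ := by
      have h2 : ((x : ℝ) ^ (τ / 2)) ^ σ ≤ mid ^ σ := Real.rpow_le_rpow hxτ.le hmidge hσ0.le
      rw [hpow] at h2
      calc (1 : ℝ) = Real.exp (-(τ / (2 * θ))) * Real.exp (τ / (2 * θ)) := by rw [← Real.exp_add]; simp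
        _ ≤ Real.exp (-(τ / (2 * θ))) * mid ^ σ := mul_le_mul_of_nonneg_left h2 (Real.exp_pos _).le
    calc y ^ stat f n = y ^ stat f n * 1 := (mul_one _).symm
      _ ≤ y ^ stat f n * (Real.exp (-(τ / (2 * θ))) * mid ^ σ) := mul_le_mul_of_nonneg_left h1 (by positivity)
      _ = Real.exp (-(τ / (2 * θ))) * (y ^ stat f n * mid ^ σ) := by ring

/-- The engine summand with the Rankin weight at member `i` (plain peeled weights elsewhere) is `y^{Ω_f(n)} · midᵢ^σ`. [folklore] -/
theorem prod_rankinSummand_eq (f : Fin k → ℤ[X]) (y z σ : ℝ) (P n : ℕ) (i : Fin k) :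
    ∏ j, (y ^ cardFactors (smoothPart (P : ℝ) (val f j n)) * (y ^ cardFactors (roughPart (P : ℝ) (val f j n)) *
      (if j = i then (smoothPart z (roughPart (P : ℝ) (val f j n)) : ℝ) ^ σ else 1))) =
      y ^ stat f n * (smoothPart z (roughPart (P : ℝ) (val f i n)) : ℝ) ^ σ := by
  rw [Finset.prod_congr rfl fun j _ => (mul_assoc _ _ _).symm, Finset.prod_mul_distrib, ← pow_stat_eq_prod_smooth_rough f y P n,
    Finset.prod_ite_eq' Finset.univ i, if_pos (Finset.mem_univ i)]

/-! ### Bounds for the density sums of the engine -/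

section Z

variable {f : Fin k → ℤ[X]} {y Kz : ℝ} {P : ℕ}

/-- The density sum over the slices in `𝒮` is `≤ K_z ∏ᵢ Σ_{m ∈ tᵢ} y^{Ω(m)}/m` whenever `𝒮 ⊆ ∏ tᵢ`. [folklore] -/
theorem Zsum_le_prod (hy : 0 ≤ y) (hKz0 : 0 ≤ Kz)
    (hKz : ∀ s : Fin k → ℕ, (∀ i, s i ≠ 0) → (∀ i, ∀ p ∈ (s i).primeFactors, p ≤ P) →
      (#((Finset.range (Finset.univ.lcm s * primorial P)).filter (fun r : ℕ =>
          ∀ i, ((s i : ℕ) : ℤ) ∣ (f i).eval (r : ℤ) ∧ ∀ p ∈ Nat.primesLE P,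
            ¬ ((p ^ ((s i).factorization p + 1) : ℕ) : ℤ) ∣ (f i).eval (r : ℤ))) : ℝ) /
        ((Finset.univ.lcm s * primorial P : ℕ) : ℝ) ≤ Kz / ((∏ i, s i : ℕ) : ℝ))
    (𝒮 : (Fin k → ℕ) → Prop) (X : ℕ) (t : Fin k → Finset ℕ)
    (ht : ∀ s, (∀ i, s i ∈ Finset.Icc 1 X) → (∀ i, ∀ p ∈ (s i).primeFactors, p ≤ P) → 𝒮 s → ∀ i, s i ∈ t i) :
    ∑ s ∈ (Fintype.piFinset fun _ : Fin k => Finset.Icc 1 X).filter (fun s => (∀ i, ∀ p ∈ (s i).primeFactors, p ≤ P) ∧ 𝒮 s),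
        y ^ cardFactors (∏ i, s i) *
          (#((Finset.range (Finset.univ.lcm s * primorial P)).filter (fun r : ℕ =>
              ∀ i, ((s i : ℕ) : ℤ) ∣ (f i).eval (r : ℤ) ∧ ∀ p ∈ Nat.primesLE P,
                ¬ ((p ^ ((s i).factorization p + 1) : ℕ) : ℤ) ∣ (f i).eval (r : ℤ))) : ℝ) /
          ((Finset.univ.lcm s * primorial P : ℕ) : ℝ) ≤ Kz * ∏ i, ∑ m ∈ t i, y ^ cardFactors m / m := by
  set box := (Fintype.piFinset fun _ : Fin k => Finset.Icc 1 X).filter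
    (fun s => (∀ i, ∀ p ∈ (s i).primeFactors, p ≤ P) ∧ 𝒮 s) with hbox
  have hpt : ∀ s ∈ box, y ^ cardFactors (∏ i, s i) *
      (#((Finset.range (Finset.univ.lcm s * primorial P)).filter (fun r : ℕ =>
          ∀ i, ((s i : ℕ) : ℤ) ∣ (f i).eval (r : ℤ) ∧ ∀ p ∈ Nat.primesLE P,
            ¬ ((p ^ ((s i).factorization p + 1) : ℕ) : ℤ) ∣ (f i).eval (r : ℤ))) : ℝ) /
      ((Finset.univ.lcm s * primorial P : ℕ) : ℝ) ≤ Kz * ∏ i, (y ^ cardFactors (s i) / (s i)) := by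
    intro s hs
    rw [hbox, Finset.mem_filter, Fintype.mem_piFinset] at hs
    have hs1 : ∀ i, s i ≠ 0 := fun i => by have := (Finset.mem_Icc.mp (hs.1 i)).1; omega
    have hd := hKz s hs1 hs.2.1
    rw [mul_div_assoc, cardFactors_finset_prod _ _ fun i _ => hs1 i, ← Finset.prod_pow_eq_pow_sum]
    calc (∏ i, y ^ cardFactors (s i)) * _ ≤ (∏ i, y ^ cardFactors (s i)) * (Kz / ((∏ i, s i : ℕ) : ℝ)) :=
          mul_le_mul_of_nonneg_left hd (Finset.prod_nonneg fun i _ => pow_nonneg hy _)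
      _ = Kz * ∏ i, (y ^ cardFactors (s i) / (s i)) := by rw [Finset.prod_div_distrib, Nat.cast_prod]; ring
  refine (Finset.sum_le_sum hpt).trans ?_
  rw [← Finset.mul_sum]
  refine mul_le_mul_of_nonneg_left ?_ hKz0
  have hsub : box ⊆ Fintype.piFinset t := by
    intro s hs
    rw [hbox, Finset.mem_filter, Fintype.mem_piFinset] at hs
    exact Fintype.mem_piFinset.mpr (ht s hs.1 hs.2.1 hs.2.2)
  have hKs0 : ∀ i, 0 ≤ ∑ m ∈ t i, y ^ cardFactors m / (m : ℝ) := fun i => Finset.sum_nonneg fun m _ => by positivity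
  calc ∑ s ∈ box, ∏ i, (y ^ cardFactors (s i) / (s i)) ≤ ∑ s ∈ Fintype.piFinset t, ∏ i, (y ^ cardFactors (s i) / (s i)) :=
        Finset.sum_le_sum_of_subset_of_nonneg hsub fun s _ _ => Finset.prod_nonneg fun i _ => by positivity
    _ = ∏ i, ∑ m ∈ t i, y ^ cardFactors m / m := (Finset.prod_univ_sum t (fun _ m => y ^ cardFactors m / m)).symm

end Z

/-- Eventually in `x`: the side conditions of clause (b). [folklore] -/
theorem rankin_eventually (X₀ T₀ : ℕ) {τ θhalf : ℝ} (L A B : ℝ) (hτ : 0 < τ) (hθ : 0 < θhalf) :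
    ∀ᶠ x : ℕ in atTop, (X₀ : ℝ) + 2 ≤ (x : ℝ) ^ (1 / 2 : ℝ) ∧ 8 ≤ x ∧ L ≤ Real.log x ∧ (T₀ : ℝ) ≤ (x : ℝ) ^ (τ / 2) ∧
      A ≤ (x : ℝ) ^ (1 / 2 : ℝ) ∧ A ≤ x ∧ B ≤ (x : ℝ) ^ θhalf := by
  have h := fun (e : ℝ) (he : 0 < e) (c : ℝ) =>
    ((tendsto_rpow_atTop he).comp tendsto_natCast_atTop_atTop).eventually_ge_atTop c
  filter_upwards [h (1 / 2) (by norm_num) ((X₀ : ℝ) + 2), eventually_ge_atTop 8,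
    (Real.tendsto_log_atTop.comp tendsto_natCast_atTop_atTop).eventually_ge_atTop L, h (τ / 2) (by positivity) (T₀ : ℝ),
    h (1 / 2) (by norm_num) A, tendsto_natCast_atTop_atTop.eventually_ge_atTop A, h θhalf hθ B]
    with x h1 h2 h3 h4 h5 h6 h7
  exact ⟨h1, h2, h3, h4, h5, h6, h7⟩

/-- The main term of the engine on a block `(X, 2X]` with `√x < X`: `(log X)^{−k} ≤ 2^k (log x)^{−k}`, so
`C (X/(log X)^k) H Z ≤ C 2^k (C_m 2^y)^k X (log x)^{yk−k} Z` once `H ≤ (C_m 2^y)^k (log x)^{yk}`. [folklore] -/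
theorem engine_mainTerm_le {C Cm y H Z x : ℝ} {k X : ℕ} (hC : 0 ≤ C) (hCm : 0 ≤ Cm) (hx : 1 < x)
    (hXr : x ^ (1 / 2 : ℝ) < X) (hZ0 : 0 ≤ Z) (hH : H ≤ (Cm * 2 ^ y) ^ k * Real.log x ^ (y * k)) :
    C * ((X : ℝ) / Real.log X ^ k) * H * Z ≤ C * 2 ^ k * (Cm * 2 ^ y) ^ k * ((X : ℝ) * Real.log x ^ (y * k - k)) * Z := by
  have hxpos : 0 < x := by linarith
  have hlogx : 0 < Real.log x := Real.log_pos hx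
  have hX0 : (0 : ℝ) < X := lt_of_le_of_lt (by positivity) hXr
  have hlogX : Real.log x / 2 ≤ Real.log X := by
    have := Real.log_le_log (by positivity) hXr.le
    rwa [Real.log_rpow hxpos, show (1 / 2 : ℝ) * Real.log x = Real.log x / 2 by ring] at this
  have hlogX0 : 0 < Real.log X := lt_of_lt_of_le (by positivity) hlogX
  have h1 : (X : ℝ) / Real.log X ^ k * Real.log x ^ (y * k) ≤ 2 ^ k * ((X : ℝ) * Real.log x ^ (y * k - k)) := by
    have h2 : (Real.log x / 2) ^ k ≤ Real.log X ^ k := pow_le_pow_left₀ (by positivity) hlogX k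
    rw [div_mul_eq_mul_div, div_le_iff₀ (pow_pos hlogX0 k)]
    have hpow : Real.log x ^ (y * k) = Real.log x ^ (y * k - k) * Real.log x ^ k := by
      rw [← Real.rpow_natCast (Real.log x) k, ← Real.rpow_add hlogx]; ring_nf
    calc (X : ℝ) * Real.log x ^ (y * k) = (X : ℝ) * Real.log x ^ (y * k - k) * (2 ^ k * (Real.log x / 2) ^ k) := by
          rw [hpow, div_pow, mul_div_cancel₀ _ (pow_ne_zero k two_ne_zero)]; ring
      _ ≤ (X : ℝ) * Real.log x ^ (y * k - k) * (2 ^ k * Real.log X ^ k) := by gcongr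
      _ = _ := by ring
  calc C * ((X : ℝ) / Real.log X ^ k) * H * Z ≤ C * ((X : ℝ) / Real.log X ^ k) * ((Cm * 2 ^ y) ^ k * Real.log x ^ (y * k)) * Z :=
        mul_le_mul_of_nonneg_right (mul_le_mul_of_nonneg_left hH (by positivity)) hZ0
    _ = C * (Cm * 2 ^ y) ^ k * ((X : ℝ) / Real.log X ^ k * Real.log x ^ (y * k)) * Z := by ring
    _ ≤ C * (Cm * 2 ^ y) ^ k * (2 ^ k * ((X : ℝ) * Real.log x ^ (y * k - k))) * Z :=
        mul_le_mul_of_nonneg_right (mul_le_mul_of_nonneg_left h1 (by positivity)) hZ0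
    _ = _ := by ring

end

end Summit.Parity.BatemanHorn.Cruxes.LSDRealSegment.ProductAnatomySubcritical
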